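import HarnessLib
import Summits.AtomisticToContinuum.FouriersLaw.Theses.HiddenChargeMazur
import Summits.AtomisticToContinuum.FouriersLaw.Theorems.HiddenChargeMazurStaticKuboStubPoissonValue
import Summits.AtomisticToContinuum.FouriersLaw.Theorems.HiddenChargeMazurStaticKuboStubKuboPairing
import Summits.AtomisticToContinuum.FouriersLaw.Theorems.HiddenChargeMazurStaticKuboStubTwoPointGronwall
import Summits.AtomisticToContinuum.FouriersLaw.Theorems.HiddenChargeMazurStaticKuboStubBrownianSupGaussTail
import Summits.AtomisticToContinuum.FouriersLaw.Theorems.HiddenChargeMazurStaticKuboStubHighEnergyDecayRate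
import Summits.AtomisticToContinuum.FouriersLaw.Theorems.HiddenChargeMazurStaticKuboStubLocalSmoothingLipschitz
import Summits.AtomisticToContinuum.FouriersLaw.Theorems.HiddenChargeMazurStaticKuboStubLasotaYorke
import Summits.AtomisticToContinuum.FouriersLaw.Theorems.HiddenChargeMazurStaticKuboStubCorrectorLipschitz
import Summits.AtomisticToContinuum.FouriersLaw.Theorems.HiddenChargeMazurStaticKuboStubTransfer

/-!
# Crux `HiddenChargeMazur.StaticKubo` PROVED — line `birth` (= `registered`), rev 4, all stubs landed
(item `stmt-AtomisticToContinuum-13510`, route `route-AtomisticToContinuum-HiddenChargeMazur`;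
sub-problem `FouriersLaw`; continuation lead `prover-line-stmt-AtomisticToContinuum-13510-c1-0`, 2026-08-17;
rev 1 registrar `planner-skel-stmt-AtomisticToContinuum-13510-0`, revs 2–3 `prover-line-stmt-AtomisticToContinuum-13510-0`.)

Crux (FIXED, concluded BY NAME below): for `pinnedChain ω₂ lam β γ` (all `> 0`), under weak-NESS
uniqueness, along any steady-state family `μ`, for every `T > 0`, `N ≥ 2` and every response limit
`D = lim_{δ→0, δ≠0} totalCurrent(μ N (T+δ/2) (T−δ/2))/δ` there is `F ∈ C²(PhaseSpace N)` with
`|F| + |∂_p F| + |∂_q F| ≤ C e^{θH}` (`θ < 1/(2T)`), `L_{T,T} F = −J` pointwise (`J = Σ_i bondCurrent i`)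
and `D·(N−1)·T² = ∫ F·J dGibbs_{N,T}`.

## Rev 3 (closed part, unchanged)

`StaticKubo_of : stub_poissonValue → stub_gradientBound → stub_kuboPairing → StaticKubo` (sorry-free);
`stub_poissonValue` LANDED (p148198), `stub_kuboPairing` LANDED (p149101).  The one open stub,
`stub_gradientBound` (every value-class `C²` solution of `L_{T,T}F = −J` has the full growth clause), is
by the previous lead's sorry-free reduction (`Lines/birth_gradientBound_reduction.lean`,
`stub_gradientBound_of_witness` + `exists_const_of_valueClass`) exactly the weighted gradient bound
`|∇u| ≤ C e^{θ₁H}`, `θ₁ < 1/(2T)`, for the Kubo corrector `u⋆(x) = ∫₀^∞ P_tJ(x) dt`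
(`Corrector.corrector_smooth`: `u⋆ = u` a.e., `u ∈ C^∞`, `L u = −J`, `|u| ≤ K_ϑ e^{ϑH}` for all `0 < ϑ < 1/T`).

## Rev 4 — the reshaping of `stub_gradientBound` (this file)

A route to the weighted gradient bound that needs NO Malliavin calculus and NO quantitative Hörmander
estimate: a Doeblin–Fortet (Lasota–Yorke) inequality for the WEIGHTED PAIR-LIPSCHITZ seminorm
`K(φ) = sup_{0<‖x−y‖≤1} |φx − φy| / (‖x−y‖ (e^{θ₁Hx} + e^{θ₁Hy}))` under the unit-time equilibrium kernel
`P_1`:  `K(P_1 φ) ≤ ½ K(φ) + C₀ ‖φ e^{-ϑH}‖_∞`  (`0 < ϑ < θ₁ < 1/(2T)`), from three inputs: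

* SYNCHRONOUS COUPLING (`stub_twoPointGronwall`, deterministic): two starts driven by the SAME Brownian
  pair differ by the solution of a random ODE (the noise is additive and cancels); pathwise Grönwall with the
  local Lipschitz rate of the drift, `C₀(1 + √H)` on energy shells (quartic potentials: `‖Hess‖ ≲ 1 + q² ≲ 1 + √H`).
  With the fixed-time exponential moments (3.4) of the tree this costs a factor `e^{C√E}` per unit time.
* HIGH-ENERGY DISSIPATION WITH A RATE (`stub_highEnergyDecayRate`, from `stub_brownianSupGaussTail`): CEHR
  Thm 5.1 as proved in the tree (`pinnedChain_lintegral_exp_hamiltonian_small`: factor `½` above `E₀`)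
  re-run with a sub-Gaussian tail for the running supremum of the Brownian pair in place of the `O(h²)` Doob
  tail (the only polynomial leak of that proof: noise threshold `m₁a`, cells `τ ≤ 2Λ₀/a`, `a⁴ = E` ⇒ tail
  `e^{-ca³} = e^{-cE^{3/4}}`; printed rate (5.1): `e^{-C₁E}`):  `E_x e^{θH(X_1)} ≤ C e^{θH(x) − cH(x)^{3/4}}`
  for `H(x) ≥ E₀`.  Since `e^{C√E} e^{-cE^{3/4}/2} → 0`, coupled pairs at high energy CONTRACT the weighted
  seminorm.
* LOCAL SMOOTHING (`stub_localSmoothingLipschitz`): on a compact energy shell, for data supported in a compact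
  energy shell, `x ↦ P_tF(x)` is Lipschitz with constant `C sup|F|` — from the in-tree smooth transition density
  `p ∈ C^∞((0,∞)×Ω×Ω)` (`pinnedChain_exists_transitionDensity`, CEHR Prop. 3.2 via the in-tree Hörmander
  theorem) and the mean value inequality (sublevel sets of `H` are convex: `H` is convex).  Low-energy pairs are
  handled by splitting `φ = φχ_R + φ(1−χ_R)`: the first part by smoothing, the second is invisible unless the
  unit-time energy exceeds `R` (probability `≤ C_{E₀} e^{-θ₁R}`).

Iterating (`stub_correctorLipschitz`) along `φ_n = ∫_n^{n+1} P_tJ dt` (`P_1φ_n = φ_{n+1}` by Chapman–Kolmogorov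
+ Fubini; `‖φ_n e^{-ϑH}‖_∞ ≤ Cϱ^n` by the in-tree mixing `totalBondCurrent_decay`, CEHR Thm 2.13) gives
`K(φ_n) ≤ C n max(½,ϱ)^n`, summable, hence a weighted pair-Lipschitz bound for `u⋆ = Σ_n φ_n`; and
(`stub_transfer`) `u = u⋆` everywhere (both continuous), `|∂u| ≤ 2A e^{θ₁H}`, so `u` is the witness of
`stub_gradientBound_of_witness`.

Stubs (7 = stubs_max), dependencies carried as HYPOTHESES so that every stub is an independent statement:
`S1 stub_twoPointGronwall`, `S2 stub_brownianSupGaussTail`, `S3 stub_highEnergyDecayRate : S2 → …`,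
`S4 stub_localSmoothingLipschitz`, `S5 stub_lasotaYorke : S1 → S3core → S4 → …` (lead),
`S6 stub_correctorLipschitz : S5core → …`, `S7 stub_transfer : S6core → (registered stub_gradientBound)`.
Composition: `stub_gradientBound := S7 (S6 (S5 S1 (S3 S2) S4))`; `StaticKubo_of` unchanged.

Disproof used: none on file (`ledger crux ls`: no `Disproof.lean`, no `Negative/`, 2026-08-17).  Refuter evidence
respected: EVIDENCE_StaticKubo.md / StaticKuboHarmonicCalibration.py (the crux statement is untouched).
-/

noncomputable section

open MeasureTheory Filter Topology
open scoped NNReal ENNReal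
open Literature.MathematicalPhysics.KineticTheory.HeatConduction Literature.MathematicalPhysics.KineticTheory
open Literature.Probability.Process OscillatorChain

namespace Summit.AtomisticToContinuum.FouriersLaw.Cruxes.StaticKubo

namespace Birth

/-! ## The landed stubs of rev 3 -/

/-- **stub 1a — `stub_poissonValue` (Poisson equation `L_{T,T} F = −J`, value class).** LANDED p148198. -/
theorem stub_poissonValue :
    ∀ ω₂ lam β γ : ℝ, 0 < ω₂ → 0 < lam → 0 < β → 0 < γ → ∀ P : Literature.MathematicalPhysics.KineticTheory.HeatConduction.OscillatorChain, P = Literature.MathematicalPhysics.KineticTheory.HeatConduction.pinnedChain ω₂ lam β γ → ∀ T : ℝ, 0 < T → ∀ N : ℕ, 2 ≤ N → ∃ F : Literature.MathematicalPhysics.KineticTheory.HeatConduction.PhaseSpace N → ℝ, ContDiff ℝ 2 F ∧ (∃ C θ : ℝ, θ < 1 / (2 * T) ∧ ∀ z : Literature.MathematicalPhysics.KineticTheory.HeatConduction.PhaseSpace N, |F z| ≤ C * Real.exp (θ * P.hamiltonian N z)) ∧ (∀ z : Literature.MathematicalPhysics.KineticTheory.HeatConduction.PhaseSpace N, P.generator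 N T T F z = -(∑ i : Fin N, P.bondCurrent N i z)) :=
  Stubs.stub_poissonValue

/-- **stub 2 — `stub_kuboPairing` (the Green–Kubo pairing of ANY value-class Poisson solution).** LANDED p149101. -/
theorem stub_kuboPairing :
    ∀ ω₂ lam β γ : ℝ, 0 < ω₂ → 0 < lam → 0 < β → 0 < γ → ∀ P : Literature.MathematicalPhysics.KineticTheory.HeatConduction.OscillatorChain, P = Literature.MathematicalPhysics.KineticTheory.HeatConduction.pinnedChain ω₂ lam β γ → (∀ (N : ℕ) (T_L T_R : ℝ), 0 < T_L → 0 < T_R → ∀ μ ν : MeasureTheory.Measure (Literature.MathematicalPhysics.KineticTheory.HeatConduction.PhaseSpace N), P.IsSteadyState N T_L T_R μ → P.IsSteadyState N T_L T_R ν → μ = ν) → ∀ μ : (N : ℕ) → ℝ → ℝ → MeasureTheory.Measure (Literature.MathematicalPhysics.KineticTheory.HeatConduction.PhaseSpace N), (∀ (N : ℕ) (T_L T_R : ℝ), 0 < T_L → 0 < T_R → P.IsSteadyState N T_L T_R (μ N T_L T_R)) → ∀ T : ℝ, 0 < T → ∀ N : ℕ, 2 ≤ N → ∀ D : ℝ,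 Filter.Tendsto (fun δ : ℝ => P.totalCurrent (μ N (T + δ / 2) (T - δ / 2)) / δ) (nhdsWithin 0 {(0 : ℝ)}ᶜ) (nhds D) → ∀ F : Literature.MathematicalPhysics.KineticTheory.HeatConduction.PhaseSpace N → ℝ, ContDiff ℝ 2 F → (∃ C θ : ℝ, θ < 1 / (2 * T) ∧ ∀ z : Literature.MathematicalPhysics.KineticTheory.HeatConduction.PhaseSpace N, |F z| ≤ C * Real.exp (θ * P.hamiltonian N z)) → (∀ z : Literature.MathematicalPhysics.KineticTheory.HeatConduction.PhaseSpace N, P.generator N T T F z = -(∑ i : Fin N, P.bondCurrent N i z)) → D * (((N : ℝ) - 1) * T ^ 2) = ∫ z, F z * (∑ i : Fin N, P.bondCurrent N i z) ∂(MeasureTheory.volume.tilted fun x => -P.hamiltonian N x / T) :=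
  Stubs.stub_kuboPairing

/-! ## The seven registered stubs of rev 4 (reshaping `stub_gradientBound`) — all LANDED -/

/-- **S1 — `stub_twoPointGronwall` (synchronous coupling, deterministic).** For the pinned chain (`ω₂, lam > 0`,
`β, γ ≥ 0`) and ANY continuous momentum-noise path `η`, two pathwise solutions `chainFlow` started at `x, y` and
driven by the SAME `η` satisfy `‖z_x(t) − z_y(t)‖ ≤ ‖x − y‖ exp(∫₀ᵗ C₀(1 + √H(z_x(s)) + √H(z_y(s))) ds)`:
the forcing cancels in the difference, which solves `d' = Y(z_x) − Y(z_y)`; the drift `Y` is Lipschitz on the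
segment `[z_x(s), z_y(s)]` with constant `C₀(1 + max q²) ≤ C₀(1 + √H(z_x(s)) + √H(z_y(s)))` (`lam q⁴/4 ≤ H`, `H`
convex so the segment stays below the larger endpoint energy); Grönwall with a time-dependent rate
(`Literature.Analysis.ODE.gronwall_integral_le`, cf. `ChainVariation.ell1_open_closed_le`). [folklore] -/
theorem stub_twoPointGronwall :
    ∀ ω₂ lam β γ : ℝ, 0 < ω₂ → 0 < lam → 0 ≤ β → 0 ≤ γ → ∀ N : ℕ, ∃ C₀ : ℝ, 0 ≤ C₀ ∧
      ∀ η : ℝ → Fin N → ℝ, Continuous η → ∀ (x y : PhaseSpace N) (t : ℝ), 0 ≤ t →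
        ‖(pinnedChain ω₂ lam β γ).chainFlow N x η t - (pinnedChain ω₂ lam β γ).chainFlow N y η t‖ ≤
          ‖x - y‖ * Real.exp (∫ s in (0 : ℝ)..t, C₀ * (1 +
            Real.sqrt ((pinnedChain ω₂ lam β γ).hamiltonian N ((pinnedChain ω₂ lam β γ).chainFlow N x η s)) +
            Real.sqrt ((pinnedChain ω₂ lam β γ).hamiltonian N ((pinnedChain ω₂ lam β γ).chainFlow N y η s)))) :=
  Stubs.stub_twoPointGronwall

/-- **S2 — `stub_brownianSupGaussTail` (sub-Gaussian tail of the running supremum of the Brownian pair).**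
`P(goodEvent a h)ᶜ ≤ C e^{-c a²/h}` for `a, h > 0`: the complement of the good event is
`{sup_{dyadic s ≤ h} |B¹_s| > a} ∪ {… B² …}`; each has a Gaussian tail (reflection-free: dyadic chaining with the
Chernoff bound for single increments, `HasSubgaussianMGF.measure_ge_le`, as in `LevyModulus.lean`; or Doob's
maximal inequality `doob_sq_maximal_ineq_of_continuous` for the exponential martingale). [folklore] -/
theorem stub_brownianSupGaussTail :
    ∃ C c : ℝ, 0 < c ∧ ∀ (a : ℝ) (h : ℝ≥0), 0 < a → 0 < (h : ℝ) →
      wienerPair (goodEvent a h)ᶜ ≤ ENNReal.ofReal (C * Real.exp (-(c * a ^ 2 / h))) :=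
  Stubs.stub_brownianSupGaussTail

/-- **S3 — `stub_highEnergyDecayRate` (CEHR Thm 5.1 for the pinned chain WITH A RATE).** Given the sub-Gaussian
running-sup tail (S2): for `ω₂, lam, β, γ > 0`, `N ≥ 2`, `T_L, T_R > 0`, `0 < θ < 1/T_max`, `t* > 0` there are
`c > 0`, `C`, `E₀` with `E_x e^{θH(X_{t*})} ≤ C exp(θH(x) − c H(x)^{3/4})` whenever `H(x) ≥ E₀`.  Proof = the tree's
`pinnedChain_lintegral_exp_hamiltonian_small` (LangevinChainTheorem51) verbatim up to Step 6, with
`measure_compl_goodEvent_le` (the `O(τ²/a⁴)` tail, the only polynomial leak) replaced by S2: noise threshold `m₁a`,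
cells `τ ≤ 2Λ₀/a`, `a⁴ = H(x)`, so `P(Nb_j) ≤ C e^{-c m₁² a³/(2Λ₀)}`; the other terms are `e^{-κγε₁t*a⁴}`,
`(t*a/Λ₀+1)e^{-θa⁴/2}` and their `1/q`-th powers. [cite: CuneoEckmannHairerReyBellet2018, Thm 5.1 eq. (5.1)] -/
theorem stub_highEnergyDecayRate :
    (∃ C c : ℝ, 0 < c ∧ ∀ (a : ℝ) (h : ℝ≥0), 0 < a → 0 < (h : ℝ) →
      wienerPair (goodEvent a h)ᶜ ≤ ENNReal.ofReal (C * Real.exp (-(c * a ^ 2 / h)))) →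
    ∀ ω₂ lam β γ : ℝ, 0 < ω₂ → 0 < lam → 0 < β → 0 < γ → ∀ N : ℕ, 1 < N → ∀ T_L T_R : ℝ, 0 < T_L → 0 < T_R →
      ∀ θ : ℝ, 0 < θ → θ < 1 / max T_L T_R → ∀ tstar : ℝ, 0 < tstar →
        ∃ c C E₀ : ℝ, 0 < c ∧ ∀ x : PhaseSpace N, E₀ ≤ (pinnedChain ω₂ lam β γ).hamiltonian N x →
          ∫⁻ ω, ENNReal.ofReal (Real.exp (θ * (pinnedChain ω₂ lam β γ).hamiltonian N
              ((pinnedChain ω₂ lam β γ).solMap N T_L T_R tstar x (pairPath ω)))) ∂wienerPair ≤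
            ENNReal.ofReal (C * Real.exp (θ * (pinnedChain ω₂ lam β γ).hamiltonian N x -
              c * (pinnedChain ω₂ lam β γ).hamiltonian N x ^ (3 / 4 : ℝ))) :=
  Stubs.stub_highEnergyDecayRate

/-- **S4 — `stub_localSmoothingLipschitz` (local smoothing on an energy shell for shell-supported data).**
For `t > 0`, `R`, `E₁`: there is `C` such that for every measurable `F` with `|F| ≤ 1` vanishing on `{H > R}`,
`x ↦ P_tF(x) = ∫ F d(transitionKernel t x)` is `C`-Lipschitz on `{H ≤ E₁}`.  Proof: the smooth density
(`pinnedChain_exists_transitionDensity`, `pinnedChain_integral_kernel_eq_integral_density`):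
`|P_tF(x) − P_tF(x')| ≤ ∫_{H≤R} |p(t,x,y) − p(t,x',y)| dy ≤ vol{H≤R} · sup ‖∂_x p‖ · ‖x−x'‖`, the sup over the
compact `B̄(0,ρ) × {H ≤ R}` with `{H ≤ E₁} ⊆ B̄(0,ρ)` (mean value inequality on the convex ball).
[cite: CuneoEckmannHairerReyBellet2018, Prop 3.2] -/
theorem stub_localSmoothingLipschitz :
    ∀ ω₂ lam β γ : ℝ, 0 < ω₂ → 0 ≤ lam → 0 ≤ β → 0 < γ → ∀ N : ℕ, 0 < N → ∀ T_L T_R : ℝ, 0 < T_L → 0 ≤ T_R →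
      ∀ t : ℝ≥0, 0 < (t : ℝ) → ∀ R E₁ : ℝ, ∃ C : ℝ, 0 ≤ C ∧ ∀ F : PhaseSpace N → ℝ, Measurable F →
        (∀ y, |F y| ≤ 1) → (∀ y, R < (pinnedChain ω₂ lam β γ).hamiltonian N y → F y = 0) →
        ∀ x x' : PhaseSpace N, (pinnedChain ω₂ lam β γ).hamiltonian N x ≤ E₁ →
          (pinnedChain ω₂ lam β γ).hamiltonian N x' ≤ E₁ →
          |(∫ y, F y ∂((pinnedChain ω₂ lam β γ).transitionKernel N T_L T_R t x)) -
              ∫ y, F y ∂((pinnedChain ω₂ lam β γ).transitionKernel N T_L T_R t x')| ≤ C * ‖x - x'‖ :=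
  Stubs.stub_localSmoothingLipschitz

/-- **S5 — `stub_lasotaYorke` (the one-step Doeblin–Fortet inequality for the weighted pair-Lipschitz seminorm;
the lead's stub).**  Given S1, the core of S3 and S4: for the pinned chain (all parameters `> 0`), `N ≥ 2`, `T > 0`,
`0 < ϑ < θ₁ < 1/(2T)` there is `C₀ ≥ 0` such that (a) for every continuous `φ` with `|φ| ≤ M e^{ϑH}` and
`|φx − φy| ≤ K‖x−y‖(e^{θ₁Hx}+e^{θ₁Hy})` (`‖x−y‖ ≤ 1`), the unit-time forecast `P_1φ = ∫ φ d(transitionKernel 1 ·)`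
satisfies the same pair bound with constant `K/2 + C₀M`; (b) for `t ≤ 1` the forecasts `P_tJ` of the total current
satisfy it with constant `C₀`.  Proof: synchronous coupling `P_tφ(x) − P_tφ(y) = E[φ(X_t^x) − φ(X_t^y)]`; on
`‖X−Y‖ ≤ 1` use the pair bound, else the value bound times `‖X−Y‖`; `‖X−Y‖ ≤ ‖x−y‖e^Λ` (S1); Cauchy–Schwarz with
`E e^{2Λ} ≤ e^{C(1+√Hx+√Hy)}` ((3.4) at fixed times + Jensen) and `(E e^{2θ₁H(X_1)})^{1/2} ≤ e^{θ₁Hx}·√C e^{-cHx^{3/4}/2}`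
(S3core at `2θ₁ < 1/T`) for high pairs; for low pairs split `φ = φχ_R + φ(1−χ_R)`, S4 for the first part and Hölder
(4,2,4) with `P(H(X_1) > R) ≤ C_{E₀}e^{-θ₁R}` for the second. [folklore] -/
theorem stub_lasotaYorke :
    (∀ ω₂ lam β γ : ℝ, 0 < ω₂ → 0 < lam → 0 ≤ β → 0 ≤ γ → ∀ N : ℕ, ∃ C₀ : ℝ, 0 ≤ C₀ ∧
      ∀ η : ℝ → Fin N → ℝ, Continuous η → ∀ (x y : PhaseSpace N) (t : ℝ), 0 ≤ t →
        ‖(pinnedChain ω₂ lam β γ).chainFlow N x η t - (pinnedChain ω₂ lam β γ).chainFlow N y η t‖ ≤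
          ‖x - y‖ * Real.exp (∫ s in (0 : ℝ)..t, C₀ * (1 +
            Real.sqrt ((pinnedChain ω₂ lam β γ).hamiltonian N ((pinnedChain ω₂ lam β γ).chainFlow N x η s)) +
            Real.sqrt ((pinnedChain ω₂ lam β γ).hamiltonian N ((pinnedChain ω₂ lam β γ).chainFlow N y η s))))) →
    (∀ ω₂ lam β γ : ℝ, 0 < ω₂ → 0 < lam → 0 < β → 0 < γ → ∀ N : ℕ, 1 < N → ∀ T_L T_R : ℝ, 0 < T_L → 0 < T_R →
      ∀ θ : ℝ, 0 < θ → θ < 1 / max T_L T_R → ∀ tstar : ℝ, 0 < tstar →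
        ∃ c C E₀ : ℝ, 0 < c ∧ ∀ x : PhaseSpace N, E₀ ≤ (pinnedChain ω₂ lam β γ).hamiltonian N x →
          ∫⁻ ω, ENNReal.ofReal (Real.exp (θ * (pinnedChain ω₂ lam β γ).hamiltonian N
              ((pinnedChain ω₂ lam β γ).solMap N T_L T_R tstar x (pairPath ω)))) ∂wienerPair ≤
            ENNReal.ofReal (C * Real.exp (θ * (pinnedChain ω₂ lam β γ).hamiltonian N x -
              c * (pinnedChain ω₂ lam β γ).hamiltonian N x ^ (3 / 4 : ℝ)))) →
    (∀ ω₂ lam β γ : ℝ, 0 < ω₂ → 0 ≤ lam → 0 ≤ β → 0 < γ → ∀ N : ℕ, 0 < N → ∀ T_L T_R : ℝ, 0 < T_L → 0 ≤ T_R →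
      ∀ t : ℝ≥0, 0 < (t : ℝ) → ∀ R E₁ : ℝ, ∃ C : ℝ, 0 ≤ C ∧ ∀ F : PhaseSpace N → ℝ, Measurable F →
        (∀ y, |F y| ≤ 1) → (∀ y, R < (pinnedChain ω₂ lam β γ).hamiltonian N y → F y = 0) →
        ∀ x x' : PhaseSpace N, (pinnedChain ω₂ lam β γ).hamiltonian N x ≤ E₁ →
          (pinnedChain ω₂ lam β γ).hamiltonian N x' ≤ E₁ →
          |(∫ y, F y ∂((pinnedChain ω₂ lam β γ).transitionKernel N T_L T_R t x)) -
              ∫ y, F y ∂((pinnedChain ω₂ lam β γ).transitionKernel N T_L T_R t x')| ≤ C * ‖x - x'‖) →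
    ∀ ω₂ lam β γ : ℝ, 0 < ω₂ → 0 < lam → 0 < β → 0 < γ → ∀ N : ℕ, 2 ≤ N → ∀ T : ℝ, 0 < T →
      ∀ ϑ θ₁ : ℝ, 0 < ϑ → ϑ < θ₁ → θ₁ < 1 / (2 * T) →
      ∃ C₀ : ℝ, 0 ≤ C₀ ∧
        (∀ φ : PhaseSpace N → ℝ, Continuous φ → ∀ Mφ Kφ : ℝ, 0 ≤ Mφ → 0 ≤ Kφ →
          (∀ x, |φ x| ≤ Mφ * Real.exp (ϑ * (pinnedChain ω₂ lam β γ).hamiltonian N x)) →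
          (∀ x y, ‖x - y‖ ≤ 1 → |φ x - φ y| ≤ Kφ * ‖x - y‖ *
            (Real.exp (θ₁ * (pinnedChain ω₂ lam β γ).hamiltonian N x) +
              Real.exp (θ₁ * (pinnedChain ω₂ lam β γ).hamiltonian N y))) →
          ∀ x y, ‖x - y‖ ≤ 1 →
            |(∫ z, φ z ∂((pinnedChain ω₂ lam β γ).transitionKernel N T T 1 x)) -
                ∫ z, φ z ∂((pinnedChain ω₂ lam β γ).transitionKernel N T T 1 y)| ≤
              (Kφ / 2 + C₀ * Mφ) * ‖x - y‖ *
                (Real.exp (θ₁ * (pinnedChain ω₂ lam β γ).hamiltonian N x) +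
                  Real.exp (θ₁ * (pinnedChain ω₂ lam β γ).hamiltonian N y))) ∧
        (∀ t : ℝ≥0, (t : ℝ) ≤ 1 → ∀ x y : PhaseSpace N, ‖x - y‖ ≤ 1 →
          |(∫ z, (∑ i : Fin N, (pinnedChain ω₂ lam β γ).bondCurrent N i z)
                ∂((pinnedChain ω₂ lam β γ).transitionKernel N T T t x)) -
              ∫ z, (∑ i : Fin N, (pinnedChain ω₂ lam β γ).bondCurrent N i z)
                ∂((pinnedChain ω₂ lam β γ).transitionKernel N T T t y)| ≤
            C₀ * ‖x - y‖ *
              (Real.exp (θ₁ * (pinnedChain ω₂ lam β γ).hamiltonian N x) +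
                Real.exp (θ₁ * (pinnedChain ω₂ lam β γ).hamiltonian N y))) :=
  Stubs.stub_lasotaYorke

/-- **S6 — `stub_correctorLipschitz` (the recursion: a weighted pair-Lipschitz bound for the Kubo corrector
`u⋆ = ∫₀^∞ P_tJ dt`).**  Given the core of S5: with `φ_n(x) := ∫_{(n,n+1]} P_tJ(x) dt` one has `P_1φ_n = φ_{n+1}`
(Chapman–Kolmogorov `pinnedChain_transitionKernel_add` + Fubini), `|φ_n| ≤ (MC/c) e^{-cn} e^{ϑH}`
(`Corrector.totalBondCurrent_decay`), the pair constant of `φ_0` is `≤ C₀` (S5 (b)) and `K_{n+1} ≤ K_n/2 + C₀M_n`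
(S5 (a)); so `Σ_n K_n < ∞`, and `u⋆ = Σ_n φ_n` pointwise (absolute convergence). [folklore] -/
theorem stub_correctorLipschitz :
    (∀ ω₂ lam β γ : ℝ, 0 < ω₂ → 0 < lam → 0 < β → 0 < γ → ∀ N : ℕ, 2 ≤ N → ∀ T : ℝ, 0 < T →
      ∀ ϑ θ₁ : ℝ, 0 < ϑ → ϑ < θ₁ → θ₁ < 1 / (2 * T) →
      ∃ C₀ : ℝ, 0 ≤ C₀ ∧
        (∀ φ : PhaseSpace N → ℝ, Continuous φ → ∀ Mφ Kφ : ℝ, 0 ≤ Mφ → 0 ≤ Kφ →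
          (∀ x, |φ x| ≤ Mφ * Real.exp (ϑ * (pinnedChain ω₂ lam β γ).hamiltonian N x)) →
          (∀ x y, ‖x - y‖ ≤ 1 → |φ x - φ y| ≤ Kφ * ‖x - y‖ *
            (Real.exp (θ₁ * (pinnedChain ω₂ lam β γ).hamiltonian N x) +
              Real.exp (θ₁ * (pinnedChain ω₂ lam β γ).hamiltonian N y))) →
          ∀ x y, ‖x - y‖ ≤ 1 →
            |(∫ z, φ z ∂((pinnedChain ω₂ lam β γ).transitionKernel N T T 1 x)) -
                ∫ z, φ z ∂((pinnedChain ω₂ lam β γ).transitionKernel N T T 1 y)| ≤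
              (Kφ / 2 + C₀ * Mφ) * ‖x - y‖ *
                (Real.exp (θ₁ * (pinnedChain ω₂ lam β γ).hamiltonian N x) +
                  Real.exp (θ₁ * (pinnedChain ω₂ lam β γ).hamiltonian N y))) ∧
        (∀ t : ℝ≥0, (t : ℝ) ≤ 1 → ∀ x y : PhaseSpace N, ‖x - y‖ ≤ 1 →
          |(∫ z, (∑ i : Fin N, (pinnedChain ω₂ lam β γ).bondCurrent N i z)
                ∂((pinnedChain ω₂ lam β γ).transitionKernel N T T t x)) -
              ∫ z, (∑ i : Fin N, (pinnedChain ω₂ lam β γ).bondCurrent N i z)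
                ∂((pinnedChain ω₂ lam β γ).transitionKernel N T T t y)| ≤
            C₀ * ‖x - y‖ *
              (Real.exp (θ₁ * (pinnedChain ω₂ lam β γ).hamiltonian N x) +
                Real.exp (θ₁ * (pinnedChain ω₂ lam β γ).hamiltonian N y)))) →
    ∀ ω₂ lam β γ : ℝ, 0 < ω₂ → 0 < lam → 0 < β → 0 < γ → ∀ N : ℕ, 2 ≤ N → ∀ T : ℝ, 0 < T →
      ∀ θ₁ : ℝ, 0 < θ₁ → θ₁ < 1 / (2 * T) →
      ∃ A : ℝ, ∀ x y : PhaseSpace N, ‖x - y‖ ≤ 1 →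
        |(∫ t in Set.Ioi (0 : ℝ), ∫ z, (∑ i : Fin N, (pinnedChain ω₂ lam β γ).bondCurrent N i z)
              ∂((pinnedChain ω₂ lam β γ).transitionKernel N T T t.toNNReal x)) -
            ∫ t in Set.Ioi (0 : ℝ), ∫ z, (∑ i : Fin N, (pinnedChain ω₂ lam β γ).bondCurrent N i z)
              ∂((pinnedChain ω₂ lam β γ).transitionKernel N T T t.toNNReal y)| ≤
          A * ‖x - y‖ *
            (Real.exp (θ₁ * (pinnedChain ω₂ lam β γ).hamiltonian N x) +
              Real.exp (θ₁ * (pinnedChain ω₂ lam β γ).hamiltonian N y)) :=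
  Stubs.stub_correctorLipschitz

/-- **S7 — `stub_transfer` (from the weighted pair-Lipschitz bound for `u⋆` to the registered `stub_gradientBound`).**
Given the conclusion of S6: at each parameter point take the smooth corrector `u` of `Corrector.corrector_smooth`
(`u⋆ = u` a.e., `L_{T,T}u = −J`, `|u| ≤ K e^{ϑH}`); `u⋆` is continuous (locally Lipschitz by S6), so `u = u⋆`
everywhere (`Continuous.ae_eq_iff_eq`); the pair bound gives `‖Du(x)‖ ≤ 2A e^{θ₁H(x)}`, hence
`|∂_{p_i}u|, |∂_{q_i}u| ≤ 2A e^{θ₁H}`; `u` is then the witness of `stub_gradientBound_of_witness`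
(`Lines/birth_gradientBound_reduction.lean`: value-class `C²` solutions differ by constants). [folklore] -/
theorem stub_transfer :
    (∀ ω₂ lam β γ : ℝ, 0 < ω₂ → 0 < lam → 0 < β → 0 < γ → ∀ N : ℕ, 2 ≤ N → ∀ T : ℝ, 0 < T →
      ∀ θ₁ : ℝ, 0 < θ₁ → θ₁ < 1 / (2 * T) →
      ∃ A : ℝ, ∀ x y : PhaseSpace N, ‖x - y‖ ≤ 1 →
        |(∫ t in Set.Ioi (0 : ℝ), ∫ z, (∑ i : Fin N, (pinnedChain ω₂ lam β γ).bondCurrent N i z)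
              ∂((pinnedChain ω₂ lam β γ).transitionKernel N T T t.toNNReal x)) -
            ∫ t in Set.Ioi (0 : ℝ), ∫ z, (∑ i : Fin N, (pinnedChain ω₂ lam β γ).bondCurrent N i z)
              ∂((pinnedChain ω₂ lam β γ).transitionKernel N T T t.toNNReal y)| ≤
          A * ‖x - y‖ *
            (Real.exp (θ₁ * (pinnedChain ω₂ lam β γ).hamiltonian N x) +
              Real.exp (θ₁ * (pinnedChain ω₂ lam β γ).hamiltonian N y))) →
    ∀ ω₂ lam β γ : ℝ, 0 < ω₂ → 0 < lam → 0 < β → 0 < γ → ∀ P : Literature.MathematicalPhysics.KineticTheory.HeatConduction.OscillatorChain, P = Literature.MathematicalPhysics.KineticTheory.HeatConduction.pinnedChain ω₂ lam β γ → ∀ T : ℝ, 0 < T → ∀ N : ℕ, 2 ≤ N → ∀ F : Literature.MathematicalPhysics.KineticTheory.HeatConduction.PhaseSpace N → ℝ, ContDiff ℝ 2 F → (∃ C θ : ℝ, θ < 1 / (2 * T) ∧ ∀ z : Literature.MathematicalPhysics.KineticTheory.HeatConduction.PhaseSpace N, |F z| ≤ C * Real.exp (θ * P.hamiltonian N z))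 → (∀ z : Literature.MathematicalPhysics.KineticTheory.HeatConduction.PhaseSpace N, P.generator N T T F z = -(∑ i : Fin N, P.bondCurrent N i z)) → ∃ C θ : ℝ, θ < 1 / (2 * T) ∧ ∀ (z : Literature.MathematicalPhysics.KineticTheory.HeatConduction.PhaseSpace N) (i : Fin N), |F z| + |Literature.MathematicalPhysics.KineticTheory.HeatConduction.partialP i F z| + |Literature.MathematicalPhysics.KineticTheory.HeatConduction.partialQ i F z| ≤ C * Real.exp (θ * P.hamiltonian N z) :=
  Stubs.stub_transfer

/-! ## The rev-3 stub `stub_gradientBound`, now COMPOSED from S1–S7 (sorry-free composition) -/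

/-- **stub 1b — `stub_gradientBound` (weighted gradient regularity of value-class Poisson solutions)**, from the
seven stubs of rev 4: `S7 (S6 (S5 S1 (S3 S2) S4))`. -/
theorem stub_gradientBound :
    ∀ ω₂ lam β γ : ℝ, 0 < ω₂ → 0 < lam → 0 < β → 0 < γ → ∀ P : Literature.MathematicalPhysics.KineticTheory.HeatConduction.OscillatorChain, P = Literature.MathematicalPhysics.KineticTheory.HeatConduction.pinnedChain ω₂ lam β γ → ∀ T : ℝ, 0 < T → ∀ N : ℕ, 2 ≤ N → ∀ F : Literature.MathematicalPhysics.KineticTheory.HeatConduction.PhaseSpace N → ℝ, ContDiff ℝ 2 F → (∃ C θ : ℝ, θ < 1 / (2 * T) ∧ ∀ z : Literature.MathematicalPhysics.KineticTheory.HeatConduction.PhaseSpace N, |F z| ≤ C * Real.exp (θ * P.hamiltonian N z)) → (∀ z : Literature.MathematicalPhysics.KineticTheory.HeatConduction.PhaseSpace N, P.generator N T T F z = -(∑ i : Fin N, P.bondCurrent N i z)) → ∃ C θ : ℝ, θ < 1 / (2 * T) ∧ ∀ (z : Literature.MathematicalPhysics.KineticTheory.HeatConduction.PhaseSpace N) (i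 : Fin N), |F z| + |Literature.MathematicalPhysics.KineticTheory.HeatConduction.partialP i F z| + |Literature.MathematicalPhysics.KineticTheory.HeatConduction.partialQ i F z| ≤ C * Real.exp (θ * P.hamiltonian N z) :=
  stub_transfer (stub_correctorLipschitz (stub_lasotaYorke stub_twoPointGronwall
    (stub_highEnergyDecayRate stub_brownianSupGaussTail) stub_localSmoothingLipschitz))

/-! ## The composition (sorry-free, unchanged since rev 3) -/

/-- **Skeleton theorem — the crux `HiddenChargeMazur.StaticKubo` BY NAME from the three rev-3 stub statements**
(sorry-free): take the value-class Poisson solution `F` of stub 1a, upgrade its growth clause by stub 1b,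
and read off the identity `D·(N−1)·T² = ⟨F,J⟩` from stub 2 (which needs only the value bound). -/
theorem StaticKubo_of
    (hValue : ∀ ω₂ lam β γ : ℝ, 0 < ω₂ → 0 < lam → 0 < β → 0 < γ → ∀ P : Literature.MathematicalPhysics.KineticTheory.HeatConduction.OscillatorChain, P = Literature.MathematicalPhysics.KineticTheory.HeatConduction.pinnedChain ω₂ lam β γ → ∀ T : ℝ, 0 < T → ∀ N : ℕ, 2 ≤ N → ∃ F : Literature.MathematicalPhysics.KineticTheory.HeatConduction.PhaseSpace N → ℝ, ContDiff ℝ 2 F ∧ (∃ C θ : ℝ, θ < 1 / (2 * T) ∧ ∀ z : Literature.MathematicalPhysics.KineticTheory.HeatConduction.PhaseSpace N, |F z| ≤ C * Real.exp (θ * P.hamiltonian N z)) ∧ (∀ z : Literature.MathematicalPhysics.KineticTheory.HeatConduction.PhaseSpace N, P.generator N T T F z = -(∑ i : Fin N, P.bondCurrent N i z)))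
    (hGrad : ∀ ω₂ lam β γ : ℝ, 0 < ω₂ → 0 < lam → 0 < β → 0 < γ → ∀ P : Literature.MathematicalPhysics.KineticTheory.HeatConduction.OscillatorChain, P = Literature.MathematicalPhysics.KineticTheory.HeatConduction.pinnedChain ω₂ lam β γ → ∀ T : ℝ, 0 < T → ∀ N : ℕ, 2 ≤ N → ∀ F : Literature.MathematicalPhysics.KineticTheory.HeatConduction.PhaseSpace N → ℝ, ContDiff ℝ 2 F → (∃ C θ : ℝ, θ < 1 / (2 * T) ∧ ∀ z : Literature.MathematicalPhysics.KineticTheory.HeatConduction.PhaseSpace N, |F z| ≤ C * Real.exp (θ * P.hamiltonian N z)) → (∀ z : Literature.MathematicalPhysics.KineticTheory.HeatConduction.PhaseSpace N, P.generator N T T F z = -(∑ i : Fin N, P.bondCurrent N i z)) → ∃ C θ : ℝ, θ < 1 / (2 * T) ∧ ∀ (z : Literature.MathematicalPhysics.KineticTheory.HeatConduction.PhaseSpace N) (i : Fin N), |F z| + |Literature.MathematicalPhysics.KineticTheory.HeatConduction.partialP i F z| + |Literature.MathematicalPhysics.KineticTheory.HeatConduction.partialQ i F z| ≤ C * Real.exp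 (θ * P.hamiltonian N z))
    (hKubo : ∀ ω₂ lam β γ : ℝ, 0 < ω₂ → 0 < lam → 0 < β → 0 < γ → ∀ P : Literature.MathematicalPhysics.KineticTheory.HeatConduction.OscillatorChain, P = Literature.MathematicalPhysics.KineticTheory.HeatConduction.pinnedChain ω₂ lam β γ → (∀ (N : ℕ) (T_L T_R : ℝ), 0 < T_L → 0 < T_R → ∀ μ ν : MeasureTheory.Measure (Literature.MathematicalPhysics.KineticTheory.HeatConduction.PhaseSpace N), P.IsSteadyState N T_L T_R μ → P.IsSteadyState N T_L T_R ν → μ = ν) → ∀ μ : (N : ℕ) → ℝ → ℝ → MeasureTheory.Measure (Literature.MathematicalPhysics.KineticTheory.HeatConduction.PhaseSpace N), (∀ (N : ℕ) (T_L T_R : ℝ), 0 < T_L → 0 < T_R → P.IsSteadyState N T_L T_R (μ N T_L T_R)) → ∀ T : ℝ, 0 < T → ∀ N : ℕ, 2 ≤ N → ∀ D : ℝ, Filter.Tendsto (fun δ : ℝ => P.totalCurrent (μ N (T + δ / 2) (T - δ / 2)) / δ) (nhdsWithin 0 {(0 : ℝ)}ᶜ) (nhds D) → ∀ F : Literature.MathematicalPhysics.KineticTheory.HeatConduction.PhaseSpace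 N → ℝ, ContDiff ℝ 2 F → (∃ C θ : ℝ, θ < 1 / (2 * T) ∧ ∀ z : Literature.MathematicalPhysics.KineticTheory.HeatConduction.PhaseSpace N, |F z| ≤ C * Real.exp (θ * P.hamiltonian N z)) → (∀ z : Literature.MathematicalPhysics.KineticTheory.HeatConduction.PhaseSpace N, P.generator N T T F z = -(∑ i : Fin N, P.bondCurrent N i z)) → D * (((N : ℝ) - 1) * T ^ 2) = ∫ z, F z * (∑ i : Fin N, P.bondCurrent N i z) ∂(MeasureTheory.volume.tilted fun x => -P.hamiltonian N x / T)) :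
    _root_.Summit.AtomisticToContinuum.FouriersLaw.Theses.HiddenChargeMazur.StaticKubo := by
  intro ω₂ lam β γ hω hl hβ hγ P hP hU μ hμ T hT N hN D hD
  obtain ⟨F, hF2, hFv, hFL⟩ := hValue ω₂ lam β γ hω hl hβ hγ P hP T hT N hN
  exact ⟨F, hF2, hGrad ω₂ lam β γ hω hl hβ hγ P hP T hT N hN F hF2 hFv hFL, hFL,
    hKubo ω₂ lam β γ hω hl hβ hγ P hP hU μ hμ T hT N hN D hD F hF2 hFv hFL⟩

/-- **The crux `HiddenChargeMazur.StaticKubo`, PROVED**: the skeleton applied to the landed stubs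
(sorry-free; every `stub_*` above is a landed theorem of `Theorems/HiddenChargeMazurStaticKuboStub*.lean`). -/
theorem StaticKubo_skeleton :
    _root_.Summit.AtomisticToContinuum.FouriersLaw.Theses.HiddenChargeMazur.StaticKubo :=
  StaticKubo_of stub_poissonValue stub_gradientBound stub_kuboPairing

end Birth

end Summit.AtomisticToContinuum.FouriersLaw.Cruxes.StaticKubo

end
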